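import Summits.HodgeConjecture.CorCM.OcticWeil13PairHodgeOfMarkman
import Summits.HodgeConjecture.CorCM.OcticWeilMixedMumfordExample
import HarnessLib

/-!
# COR-CM — two `(1,3)`-types over one octic CM field: NON-VACUITY (Mumford's fourfold, two `(1,3)`-types of `F(i)` split by it,
# and the CM curve of `ℚ(i)` inhabit every hypothesis)

Cell `pub-hodgecm2` (COR-CM), seat b30 gen 21 (2026-08-22); count-neutral own lane OCTIC-WEIL-EIGHTFOLD.  Theorems only; no
definition, no named fact of its own, no `sorry`.

`exists_hypotheses_octicWeil13Pair`: the hypotheses of `OcticWeil13Pair.hodgeConjectureFor_biproduct_comp_vec_of_isSimple_of_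
markmanP` are INHABITED — Mumford–Pohlmann's octic CM field `K = F(i) ⊃ ℚ(i)`, `Φ = Φ_P` (`|P| = 2`, SIMPLE realisation `B`), and
the two `(1,3)`-types `Φ'_0`, `Φ'_2` read through a frame of `Φ_P` (`exists_cmType13_of_frame`) — the `τ`-member of `Φ'_0` lies
IN `Φ_P`, that of `Φ'_2` OUTSIDE — all realised by the tree's `cmAbelianVarietyRealised_holds`, and a CM elliptic curve of
`ℚ(i)`; `hodgeConjectureFor_mumford13Pair_of_markman`: hence Markman's two theorems give the Hodge conjecture for every product
of copies of these four varieties, whose Hodge rings contain the EIGHTFOLD Weil classes of `B'₁ × B̄'₂`.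
HONEST FRAMING: conditional on the two displayed Markman binders; `HC_CM` is not asserted.

## References
* [Pohlmann1968] H. Pohlmann, Ann. of Math. 88 (1968), §3.  [vanGeemen1994HodgeAV] Thm. 4.5, 4.7.  [Shimura1998] §6.2 Thm. 3,
  §8.2 Prop. 26.  [Markman2025SurveySecant] arXiv:2509.23403, Thm. 1.2.  [Markman2025SecantWeil] arXiv:2502.03415, Thm 1.5.1.
-/

noncomputable section

open CategoryTheory CategoryTheory.Limits NumberField

namespace Summit.HodgeConjecture.CorCM.OcticWeil13Pair.MumfordExample

open Literature.AlgebraicGeometry Literature.AlgebraicGeometry.Motives Literature.AlgebraicGeometry.HodgeTheory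
open Literature.AlgebraicGeometry.ComplexMultiplication (IsCMTypeRealisation)
open Literature.AlgebraicTopology.SingularHomology
open Literature.AlgebraicGeometry.Pohlmann1968.MumfordFourfold (K Qi j weilType finrank_K isSimple_and_exists_exceptional)
open Literature.NumberTheory.NumberFields.MumfordQuartic (F)
open Literature.NumberTheory.ComplexMultiplication (CMTypeCount.single CMTypeCount.single_val)
open Summit.HodgeConjecture.CorCM.Census.OcticWeilOrbit (signTab permTab_facts)
open Summit.HodgeConjecture.CorCM.Census.OcticWeilMixed (signTabM signTabM_two)
open Summit.HodgeConjecture.CorCM.OcticWeilOrbit (card_filter_symm_true inr_mem_phi₂_iff_signTab)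
open Summit.HodgeConjecture.CorCM.OcticWeilFourfold (exists_frame₂)
open Summit.HodgeConjecture.CorCM.OcticWeilFourfold.MumfordExample (isCMField_Qi finrank_Qi card_filter_comp_j_eq_two)
open Summit.HodgeConjecture.CorCM.OcticWeilMixed.MumfordExample (exists_cmType13_of_frame count_of_frame13)

open scoped Classical

/-! ## §1 The position of a frame-read `(1,3)`-type relative to the frame's `(2,2)`-type -/

variable {L : Type} [Field L] {l : Type} [Field l] {e : (L →+* ℂ) ≃ Fin 4 × Bool} {i : l →+* L} {τ : l →+* ℂ}

/-- Labels of a frame-read `(1,3)`-type: `e⁻¹(a, true) ∈ Φ'_c ⟺ a = c`. [folklore] -/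
theorem symm_mem_iff_of_frame13 {c : Fin 4} {Φ' : CMType L} (hΦ' : ∀ s, s ∈ Φ'.1 ↔ (e s).2 = signTabM c 0 2 (e s).1)
    (a : Fin 4) : e.symm (a, true) ∈ Φ'.1 ↔ a = c := by
  rw [hΦ', Equiv.apply_symm_apply, signTabM_two, permTab_facts.2.2]
  change true = decide (a = c) ↔ a = c
  by_cases h : a = c
  · rw [decide_eq_true h]; simp [h]
  · rw [decide_eq_false h]; simp [h]

/-- **The meeting counts**: for `Φ` read straight as `I_0` and `Φ'_c` read as the `(1,3)`-type at position `c`,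
`#{s | s ∘ i = τ, s ∈ Φ'_c ∩ Φ} = [c ∈ I_0]` — `1` for `c = 0`, `0` for `c = 2`. [folklore] -/
theorem count_meet_of_frame13 [Fintype (L →+* ℂ)] (he_sign : ∀ s, (e s).2 = true ↔ s.comp i = τ) {Φ : CMType L}
    (hΦ : ∀ s, s ∈ Φ.1 ↔ (e s).2 = signTab 0 0 (e s).1) {c : Fin 4} {Φ' : CMType L}
    (hΦ' : ∀ s, s ∈ Φ'.1 ↔ (e s).2 = signTabM c 0 2 (e s).1) :
    (Finset.univ.filter fun s : L →+* ℂ => s.comp i = τ ∧ (s ∈ Φ'.1 ∧ s ∈ Φ.1)).card = if signTab 0 0 c then 1 else 0 := by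
  classical
  have hreadΦ : ∀ a : Fin 4, e.symm (a, true) ∈ Φ.1 ↔ signTab 0 0 a = true := fun a => by
    rw [hΦ, Equiv.apply_symm_apply]; exact eq_comm
  rw [← card_filter_symm_true he_sign (fun s => s ∈ Φ'.1 ∧ s ∈ Φ.1)]
  have hset : (Finset.univ.filter fun a : Fin 4 => e.symm (a, true) ∈ Φ'.1 ∧ e.symm (a, true) ∈ Φ.1) =
      if signTab 0 0 c then {c} else ∅ := by
    ext a
    simp only [Finset.mem_filter, Finset.mem_univ, true_and, symm_mem_iff_of_frame13 hΦ' a, hreadΦ a]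
    split_ifs with h
    · simp only [Finset.mem_singleton]
      exact ⟨fun h' => h'.1, fun h' => ⟨h', h' ▸ h⟩⟩
    · simp only [Finset.notMem_empty, iff_false, not_and]
      rintro rfl; exact h
  rw [hset]
  split_ifs <;> simp

/-! ## §2 The hypotheses of the theorem are inhabited; Mumford's products -/

/-- **NON-VACUITY.**  There exist an octic CM field `K`, an imaginary quadratic CM field `k`, `i : k → K`, `τ : k → ℂ`, a CM type
`Φ` of `k`-signature `(2,2)` with a SIMPLE realisation `B`, CM types `Φ'₁`, `Φ'₂` of `k`-signature `(1,3)` whose `τ`-members lie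
in `Φ` resp. outside `Φ`, with realisations, and a CM elliptic curve `E ⊨ (k; Ψ ∋ τ)` — Mumford's `F(i) ⊃ ℚ(i)`, `Φ = Φ_P`,
`Φ'₁ = Φ'_0`, `Φ'₂ = Φ'_2` through a frame of `Φ_P`, all realised by `cmAbelianVarietyRealised_holds`. [cite: Pohlmann1968, §3]
[cite: vanGeemen1994HodgeAV, Thm. 4.5] [cite: Shimura1998, §6.2 Thm. 3] -/
theorem exists_hypotheses_octicWeil13Pair :
    ∃ (K k : Type) (_ : Field K) (_ : NumberField K) (_ : IsCMField K) (_ : Field k) (_ : NumberField k) (_ : IsCMField k)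
      (i : k →+* K) (τ : k →+* ℂ) (Φ Φ'₁ Φ'₂ : CMType K) (B B'₁ B'₂ : AbelianVariety ℂ)
      (ιB : 𝓞 K →+* End B) (θB : K →+* Module.End ℂ (complexBetti B.X 1))
      (ι₁ : 𝓞 K →+* End B'₁) (θ₁ : K →+* Module.End ℂ (complexBetti B'₁.X 1))
      (ι₂ : 𝓞 K →+* End B'₂) (θ₂ : K →+* Module.End ℂ (complexBetti B'₂.X 1))
      (Ψ : CMType k) (E : AbelianVariety ℂ) (ιE : 𝓞 k →+* End E) (θE : k →+* Module.End ℂ (complexBetti E.X 1)),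
      Module.finrank ℚ K = 8 ∧ Module.finrank ℚ k = 2 ∧
      IsCMTypeRealisation Φ B ιB θB ∧ B.IsSimple ∧ IsCMTypeRealisation Φ'₁ B'₁ ι₁ θ₁ ∧ IsCMTypeRealisation Φ'₂ B'₂ ι₂ θ₂ ∧
      IsCMTypeRealisation Ψ E ιE θE ∧ τ ∈ Ψ.1 ∧
      (Finset.univ.filter fun s : K →+* ℂ => s.comp i = τ ∧ s ∈ Φ.1).card = 2 ∧
      (Finset.univ.filter fun s : K →+* ℂ => s.comp i = τ ∧ s ∈ Φ'₁.1).card = 1 ∧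
      (Finset.univ.filter fun s : K →+* ℂ => s.comp i = τ ∧ s ∈ Φ'₂.1).card = 1 ∧
      (Finset.univ.filter fun s : K →+* ℂ => s.comp i = τ ∧ (s ∈ Φ'₁.1 ∧ s ∈ Φ.1)).card = 1 ∧
      (Finset.univ.filter fun s : K →+* ℂ => s.comp i = τ ∧ (s ∈ Φ'₂.1 ∧ s ∈ Φ.1)).card = 0 := by
  haveI : IsCMField Qi := isCMField_Qi
  obtain ⟨P, -, hP⟩ := Finset.exists_subset_card_eq (s := (Finset.univ : Finset (F →+* ℂ))) (n := 2)
    (by rw [Finset.card_univ, Literature.NumberTheory.NumberFields.MumfordQuartic.card_embeddings]; norm_num)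
  obtain ⟨B, ιB, θB, hB⟩ := cmAbelianVarietyRealised_holds K (weilType P)
  obtain ⟨τ⟩ : Nonempty (Qi →+* ℂ) := inferInstance
  obtain ⟨E, ιE, θE, hE⟩ := cmAbelianVarietyRealised_holds Qi (CMTypeCount.single finrank_Qi τ)
  have hττ : ComplexEmbedding.conjugate τ ≠ τ := QuarticCM.conjugate_ne τ
  have hk : ∀ σ : Qi →+* ℂ, σ = τ ∨ σ = ComplexEmbedding.conjugate τ := fun σ =>
    QuarticCM.eq_or_eq_conjugate_of_quadratic finrank_Qi τ σ
  obtain ⟨e, he_sign, he_conj, hΦP⟩ := exists_frame₂ finrank_K finrank_Qi j hττ hk (weilType P)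
    (card_filter_comp_j_eq_two hP τ)
  have hr : ∀ s, s ∈ (weilType P).1 ↔ (e s).2 = signTab 0 0 (e s).1 := fun s => by
    rw [hΦP s, inr_mem_phi₂_iff_signTab]
  obtain ⟨Φ'₁, hr₁⟩ := exists_cmType13_of_frame he_conj 0
  obtain ⟨Φ'₂, hr₂⟩ := exists_cmType13_of_frame he_conj 2
  obtain ⟨B'₁, ι₁, θ₁, hB₁⟩ := cmAbelianVarietyRealised_holds K Φ'₁
  obtain ⟨B'₂, ι₂, θ₂, hB₂⟩ := cmAbelianVarietyRealised_holds K Φ'₂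
  have hin := count_meet_of_frame13 he_sign hr hr₁
  have hout := count_meet_of_frame13 he_sign hr hr₂
  rw [show signTab 0 0 0 = true by decide, if_pos rfl] at hin
  rw [show signTab 0 0 2 = false by decide, if_neg Bool.false_ne_true] at hout
  exact ⟨K, Qi, inferInstance, inferInstance, inferInstance, inferInstance, inferInstance, inferInstance, j, τ, weilType P,
    Φ'₁, Φ'₂, B, B'₁, B'₂, ιB, θB, ι₁, θ₁, ι₂, θ₂, CMTypeCount.single finrank_Qi τ, E, ιE, θE, finrank_K, finrank_Qi, hB,
    (isSimple_and_exists_exceptional hP hB).1, hB₁, hB₂, hE, by rw [CMTypeCount.single_val]; rfl,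
    card_filter_comp_j_eq_two hP τ, count_of_frame13 he_sign hr₁, count_of_frame13 he_sign hr₂, hin, hout⟩

/-- **MUMFORD'S PRODUCTS WITH TWO `(1,3)`-TYPES: the Hodge conjecture for every product of copies of `E, B, B'₁, B'₂`, GIVEN ONLY
Markman's two theorems**, where `B ⊨ (F(i); Φ_P)` (`|P| = 2`, simple), `B'₁`, `B'₂` realise the `(1,3)`-types at positions `0` and
`2` of a frame `e` of `Φ_P` over `(j, τ)`, and `E` is a CM elliptic curve of `ℚ(i)`. [cite: Markman2025SurveySecant, Thm. 1.2]
[cite: Markman2025SecantWeil, Thm 1.5.1] [cite: Pohlmann1968, §3] -/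
theorem hodgeConjectureFor_mumford13Pair_of_markman (hW4 : Markman2025_weilClasses_algebraic_abelianFourfold)
    (hM6 : Markman2025_weilClasses_algebraic_hyperbolicSixfold)
    {N : ℕ} {P : Finset (F →+* ℂ)} (hP : P.card = 2) {τ : Qi →+* ℂ} {e : (K →+* ℂ) ≃ Fin 4 × Bool}
    (he_sign : ∀ s, (e s).2 = true ↔ s.comp j = τ)
    {Φ'₁ Φ'₂ : CMType K} (hr : ∀ s, s ∈ (weilType P).1 ↔ (e s).2 = signTab 0 0 (e s).1)
    (hr₁ : ∀ s, s ∈ Φ'₁.1 ↔ (e s).2 = signTabM 0 0 2 (e s).1) (hr₂ : ∀ s, s ∈ Φ'₂.1 ↔ (e s).2 = signTabM 2 0 2 (e s).1)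
    {B B'₁ B'₂ : AbelianVariety ℂ} {ιB : 𝓞 K →+* End B} {θB : K →+* Module.End ℂ (complexBetti B.X 1)}
    {ι₁ : 𝓞 K →+* End B'₁} {θ₁ : K →+* Module.End ℂ (complexBetti B'₁.X 1)}
    {ι₂ : 𝓞 K →+* End B'₂} {θ₂ : K →+* Module.End ℂ (complexBetti B'₂.X 1)}
    (hB : IsCMTypeRealisation (weilType P) B ιB θB) (hB₁ : IsCMTypeRealisation Φ'₁ B'₁ ι₁ θ₁)
    (hB₂ : IsCMTypeRealisation Φ'₂ B'₂ ι₂ θ₂)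
    {Ψ : CMType Qi} {E : AbelianVariety ℂ} {ιE : 𝓞 Qi →+* End E} {θE : Qi →+* Module.End ℂ (complexBetti E.X 1)}
    (hE : IsCMTypeRealisation Ψ E ιE θE) (hτΨ : τ ∈ Ψ.1) (κ : Fin N → Fin 4) :
    HodgeConjectureFor (⨁ fun m => (![E, B, B'₁, B'₂] : Fin 4 → AbelianVariety ℂ) (κ m)).dim
      (⨁ fun m => (![E, B, B'₁, B'₂] : Fin 4 → AbelianVariety ℂ) (κ m)).X := by
  haveI : IsCMField Qi := isCMField_Qi
  have hin := count_meet_of_frame13 he_sign hr hr₁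
  have hout := count_meet_of_frame13 he_sign hr hr₂
  rw [show signTab 0 0 0 = true by decide, if_pos rfl] at hin
  rw [show signTab 0 0 2 = false by decide, if_neg Bool.false_ne_true] at hout
  exact hodgeConjectureFor_biproduct_comp_vec_of_isSimple_of_markmanP hW4 hM6 finrank_K finrank_Qi j hB
    (isSimple_and_exists_exceptional hP hB).1 hB₁ hB₂ hE hτΨ (card_filter_comp_j_eq_two hP τ) (count_of_frame13 he_sign hr₁)
    (count_of_frame13 he_sign hr₂) hin hout κ

end Summit.HodgeConjecture.CorCM.OcticWeil13Pair.MumfordExample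

end
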